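import Summits.QuantumFields.YangMills.Theorems.ColdStartUniversalityLatticeLangevinRidgeDeterminacy
import Summits.QuantumFields.YangMills.Theorems.ColdStartUniversalityLatticeLangevinHeatKernelSU2
import Summits.QuantumFields.YangMills.Theorems.ColdStartUniversalityLatticeLangevinRegularFlow
import Summits.QuantumFields.YangMills.Theorems.ColdStartUniversalityColdStartSolutionsExistNoise
import HarnessLib

/-!
# Route `ColdStartUniversality`, crux K_A1 `UniformColdStartMixing` (stmt-QuantumFields-24809), rung `stub_fixedCutoffMixing`:
# the law of the `β' = 0` SZZ dynamics is the heat kernel of `SU(2)^E`; Doeblin's minorisation at `β' = 0`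

Helper file (seat `ym-line-csu-p1`, g7).  For EVERY solution `U` of the SU(2) lattice Langevin dynamics at `β' = 0` started
at `z` (any probability space, any flat Brownian driver) and every `t > 0`,

  `law(U_t) = (∏_e h_t(y_e z_e⁻¹)) · Haar^{⊗E}(dy)`,  `h_t = Σ_n (n+1) e^{-n(n+2)t/2} χ_n`  (`map_eq_heatKernel_beta_zero`):

the latitude expectations `integral_prod_gegenbauer_latitude` (Dynkin + Chebyshev eigenfunctions) and the character pairing
`integral_su2Char_mul_heatKernelSU2` give the same ridge moments, and ridge moments determine the measure
(`measure_eq_of_forall_integral_prod_gegenbauer_eq`).  Since `h_t ≥ 1/2` for `t ≥ 2`, the transition kernels at time `2`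
dominate `2^{-|E|} Haar^{⊗E}` uniformly in the start (`doeblin_beta_zero`): the input (D) of `fixedCutoffMixing_of_doeblin`
AT `β' = 0`, i.e. for Brownian motion on `SU(2)^E`.  (The transfer to `β' > 0` — discrete Girsanov via Euler schemes —
is the remaining E-block of the g7 plan in `Cruxes/UniformColdStartMixing/Lines/rung_fixedCutoffMixing.md`.)  No definition,
no sorry.  RECORD-rung R3 plumbing; nothing here bears on the mass gap.
-/

set_option autoImplicit false

noncomputable section

namespace Summit.QuantumFields.YangMills.Theorems.ColdStartUniversality

open MeasureTheory Finset ProbabilityTheory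
open scoped BigOperators NNReal ENNReal
open Literature.MathematicalPhysics.QuantumFieldTheory
open Literature.MathematicalPhysics.QuantumFieldTheory.Tomboulis2007 (su2Char)
open Literature.MathematicalPhysics.QuantumLattice (fundamentalRep fundamentalLatticeRep)
open Literature.Analysis.SpecialFunctions (gegenbauerSum)
open Literature.Probability.Process

variable {L : ℕ} [NeZero L]

/-- The product heat kernel `y ↦ ∏_e h_t(y_e z_e⁻¹)` is continuous on `SU(2)^E`. [folklore] -/
theorem continuous_prod_heatKernelSU2 {t : ℝ} (ht : 0 < t) (z : GaugeConfig 3 L (Matrix.specialUnitaryGroup (Fin 2) ℂ)) :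
    Continuous fun y : GaugeConfig 3 L (Matrix.specialUnitaryGroup (Fin 2) ℂ) =>
      ∏ e, ∑' n : ℕ, ((n : ℝ) + 1) * Real.exp (-((n : ℝ) * ((n : ℝ) + 2) / 2) * t) * su2Char n (y e * (z e)⁻¹) :=
  continuous_finsetProd _ fun e _ => (continuous_heatKernelSU2 ht).comp ((continuous_apply e).mul continuous_const)

/-- The product heat kernel is bounded below by `2^{-|E|}` for `t ≥ 2`. [folklore] -/
theorem pow_half_le_prod_heatKernelSU2 {t : ℝ} (ht : 2 ≤ t) (z y : GaugeConfig 3 L (Matrix.specialUnitaryGroup (Fin 2) ℂ)) :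
    (1 / 2 : ℝ) ^ Fintype.card (Edge 3 L) ≤
      ∏ e, ∑' n : ℕ, ((n : ℝ) + 1) * Real.exp (-((n : ℝ) * ((n : ℝ) + 2) / 2) * t) * su2Char n (y e * (z e)⁻¹) := by
  rw [← Finset.card_univ, ← Finset.prod_const]
  exact Finset.prod_le_prod (fun e _ => by norm_num) fun e _ => half_le_heatKernelSU2 ht _

/-- **Ridge moments of the product heat kernel measure**: for `t > 0`, directions `g` and degrees `m`,
`∫ ∏_e U_{m_e}(⟨ρ g_e, ρ y_e⟩) ∏_e h_t(y_e z_e⁻¹) dHaar^{⊗E}(y) = e^{-t Σ m_e(m_e+2)/2} ∏_e U_{m_e}(⟨ρ g_e, ρ z_e⟩)`. [folklore] -/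
theorem integral_prod_gegenbauer_mul_prod_heatKernel {t : ℝ} (ht : 0 < t)
    (z g : Edge 3 L → Matrix.specialUnitaryGroup (Fin 2) ℂ) (m : Edge 3 L → ℕ) :
    ∫ y, (∏ e, gegenbauerSum 1 (m e) (hsForm 2 (fundamentalRep (Fin 2) (g e)) (fundamentalRep (Fin 2) (y e)) / 2)) *
        (∏ e, ∑' n : ℕ, ((n : ℝ) + 1) * Real.exp (-((n : ℝ) * ((n : ℝ) + 2) / 2) * t) * su2Char n (y e * (z e)⁻¹))
      ∂(Measure.pi fun _ : Edge 3 L => haarProbability (Matrix.specialUnitaryGroup (Fin 2) ℂ)) =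
    Real.exp (-(∑ e, (m e : ℝ) * ((m e : ℝ) + 2) / 2) * t) *
      ∏ e, gegenbauerSum 1 (m e) (hsForm 2 (fundamentalRep (Fin 2) (g e)) (fundamentalRep (Fin 2) (z e)) / 2) := by
  haveI : IsProbabilityMeasure (haarProbability (Matrix.specialUnitaryGroup (Fin 2) ℂ)) := inferInstance
  simp_rw [← Finset.prod_mul_distrib]
  rw [integral_fintype_prod_eq_prod (𝕜 := ℝ)
    (f := fun e (x : Matrix.specialUnitaryGroup (Fin 2) ℂ) =>
      gegenbauerSum 1 (m e) (hsForm 2 (fundamentalRep (Fin 2) (g e)) (fundamentalRep (Fin 2) x) / 2) *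
      ∑' n : ℕ, ((n : ℝ) + 1) * Real.exp (-((n : ℝ) * ((n : ℝ) + 2) / 2) * t) * su2Char n (x * (z e)⁻¹))]
  have hedge : ∀ e, ∫ x, gegenbauerSum 1 (m e) (hsForm 2 (fundamentalRep (Fin 2) (g e)) (fundamentalRep (Fin 2) x) / 2) *
      (∑' n : ℕ, ((n : ℝ) + 1) * Real.exp (-((n : ℝ) * ((n : ℝ) + 2) / 2) * t) * su2Char n (x * (z e)⁻¹))
      ∂(haarProbability (Matrix.specialUnitaryGroup (Fin 2) ℂ)) =
      Real.exp (-((m e : ℝ) * ((m e : ℝ) + 2) / 2) * t) *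
        gegenbauerSum 1 (m e) (hsForm 2 (fundamentalRep (Fin 2) (g e)) (fundamentalRep (Fin 2) (z e)) / 2) := by
    intro e
    simp_rw [← su2Char_mul_inv_eq_gegenbauerSum]
    exact integral_su2Char_mul_heatKernelSU2 ht (m e) (g e) (z e)
  simp_rw [hedge]
  rw [Finset.prod_mul_distrib, ← Real.exp_sum, ← Finset.sum_mul, ← Finset.sum_neg_distrib]

/-- **The law of the `β' = 0` SZZ dynamics is the product heat kernel times Haar** (for any solution from a
deterministic start on any space): for `t ≥ 2`,
`P ∘ (U_t)⁻¹ = (∏_e h_t(y_e z_e⁻¹)) · (⊗_e Haar)(dy)`.  (`t ≥ 2` only enters through the positivity `h_t ≥ 1/2` used to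
write the density with `ENNReal.ofReal`.) [folklore] -/
theorem map_eq_heatKernel_beta_zero {t : ℝ≥0} (ht : 2 ≤ (t : ℝ)) (z : GaugeConfig 3 L (Matrix.specialUnitaryGroup (Fin 2) ℂ))
    {Ω : Type} [MeasurableSpace Ω] {P : Measure Ω} [IsProbabilityMeasure P]
    {W : ℝ≥0 → Ω → (Edge 3 L × NoiseIdx 2 → ℝ)} (hW : IsFlatBrownian W P)
    {U : ℝ≥0 → Ω → GaugeConfig 3 L (Matrix.specialUnitaryGroup (Fin 2) ℂ)} (hU0 : ∀ ω, U 0 ω = z)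
    (hU : (latticeLangevinDynamics (fundamentalLatticeRep 2) 0).IsSolution (fundamentalRep (Fin 2)) hW.natFiltration P W U) :
    P.map (U t) = (Measure.pi fun _ : Edge 3 L => haarProbability (Matrix.specialUnitaryGroup (Fin 2) ℂ)).withDensity
      (fun y => ENNReal.ofReal (∏ e, ∑' n : ℕ, ((n : ℝ) + 1) * Real.exp (-((n : ℝ) * ((n : ℝ) + 2) / 2) * t) *
        su2Char n (y e * (z e)⁻¹))) := by
  classical
  haveI := secondCountableTopology_su2
  haveI := borelSpace_config L
  haveI : IsProbabilityMeasure (haarProbability (Matrix.specialUnitaryGroup (Fin 2) ℂ)) := inferInstance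
  have ht0 : 0 < (t : ℝ) := by linarith
  -- the regular flow on the product Wiener space realises the same law (uniqueness in law)
  haveI := isProbabilityMeasure_piWiener (Edge 3 L × NoiseIdx 2)
  have hWc := isFlatBrownian_piWiener 3 L (NoiseIdx 2)
  obtain ⟨Uc, G, hUc, hUm, -, -, -⟩ := exists_regularFlow L 0 hWc
  have hlaw : P.map (U t) = (Measure.pi fun _ : Edge 3 L × NoiseIdx 2 => preWienerMeasure).map (Uc z t) :=
    lawUnique_of_start 0 z hW hWc hU0 hU (fun ω => (hUc z).1 ω) (hUc z).2 t
  rw [hlaw]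
  -- abbreviations
  set H : Measure (GaugeConfig 3 L (Matrix.specialUnitaryGroup (Fin 2) ℂ)) :=
    Measure.pi fun _ : Edge 3 L => haarProbability (Matrix.specialUnitaryGroup (Fin 2) ℂ) with hH
  set k : GaugeConfig 3 L (Matrix.specialUnitaryGroup (Fin 2) ℂ) → ℝ := fun y =>
    ∏ e, ∑' n : ℕ, ((n : ℝ) + 1) * Real.exp (-((n : ℝ) * ((n : ℝ) + 2) / 2) * t) * su2Char n (y e * (z e)⁻¹) with hk
  have hk_cont : Continuous k := continuous_prod_heatKernelSU2 ht0 z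
  have hk_nonneg : ∀ y, 0 ≤ k y := fun y =>
    le_trans (by positivity) (pow_half_le_prod_heatKernelSU2 ht z y)
  obtain ⟨C, -, hC⟩ := exists_abs_le_of_continuous hk_cont
  have hk_meas : Measurable fun y => ENNReal.ofReal (k y) := ENNReal.measurable_ofReal.comp hk_cont.measurable
  haveI : IsProbabilityMeasure H := by rw [hH]; infer_instance
  haveI : IsFiniteMeasure (H.withDensity fun y => ENNReal.ofReal (k y)) := by
    refine isFiniteMeasure_withDensity ?_
    have h1 : ∫⁻ y, ENNReal.ofReal (k y) ∂H ≤ ∫⁻ _y, ENNReal.ofReal C ∂H :=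
      lintegral_mono fun y => ENNReal.ofReal_le_ofReal ((le_abs_self _).trans (hC y))
    rw [lintegral_const, measure_univ, mul_one] at h1
    exact ne_top_of_le_ne_top ENNReal.ofReal_ne_top h1
  have hmU : Measurable (Uc z t) := ((hUc z).2.adapted t).mono (hWc.natFiltration.le t) le_rfl
  haveI : IsProbabilityMeasure ((Measure.pi fun _ : Edge 3 L × NoiseIdx 2 => preWienerMeasure).map (Uc z t)) :=
    Measure.isProbabilityMeasure_map hmU.aemeasurable
  -- ridge moments agree
  refine measure_eq_of_forall_integral_prod_gegenbauer_eq (L := L) fun g m => ?_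
  have hcontF : Continuous fun y : GaugeConfig 3 L (Matrix.specialUnitaryGroup (Fin 2) ℂ) =>
      ∏ e, gegenbauerSum 1 (m e) (hsForm 2 (fundamentalRep (Fin 2) (g e)) (fundamentalRep (Fin 2) (y e)) / 2) :=
    continuous_prod_gegenbauer_latitude g m
  rw [integral_map hmU.aemeasurable hcontF.aestronglyMeasurable]
  rw [integral_prod_gegenbauer_latitude hWc Uc hUc hUm z g m t]
  rw [integral_withDensity_eq_integral_toReal_smul hk_meas (Filter.Eventually.of_forall fun y => ENNReal.ofReal_lt_top)]
  simp_rw [ENNReal.toReal_ofReal (hk_nonneg _), smul_eq_mul]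
  rw [show (fun y => k y * ∏ e, gegenbauerSum 1 (m e) (hsForm 2 (fundamentalRep (Fin 2) (g e)) (fundamentalRep (Fin 2) (y e)) / 2))
    = fun y => (∏ e, gegenbauerSum 1 (m e) (hsForm 2 (fundamentalRep (Fin 2) (g e)) (fundamentalRep (Fin 2) (y e)) / 2)) * k y
    from funext fun y => mul_comm _ _]
  rw [hk, hH, integral_prod_gegenbauer_mul_prod_heatKernel ht0 z g m]

/-- **Doeblin's minorisation for the `β' = 0` SZZ dynamics (Brownian motion on `SU(2)^E`).**  For any family of Markov
kernels realising the transition laws of the `β' = 0` dynamics, `2^{-|E|} · Haar^{⊗E} ≤ κ_2(z, ·)` for every start `z`: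
the input (D) of `fixedCutoffMixing_of_doeblin` at `β' = 0`. [folklore] -/
theorem doeblin_beta_zero
    (κ : ℝ≥0 → Kernel (GaugeConfig 3 L (Matrix.specialUnitaryGroup (Fin 2) ℂ))
      (GaugeConfig 3 L (Matrix.specialUnitaryGroup (Fin 2) ℂ)))
    (hreal : ∀ (t : ℝ≥0) (x : GaugeConfig 3 L (Matrix.specialUnitaryGroup (Fin 2) ℂ))
        (Ω : Type) [MeasurableSpace Ω] (P : Measure Ω) [IsProbabilityMeasure P]
        (W : ℝ≥0 → Ω → (Edge 3 L × NoiseIdx 2 → ℝ)) (hW : IsFlatBrownian W P)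
        (U : ℝ≥0 → Ω → GaugeConfig 3 L (Matrix.specialUnitaryGroup (Fin 2) ℂ)),
        (∀ ω, U 0 ω = x) →
        (latticeLangevinDynamics (fundamentalLatticeRep 2) 0).IsSolution (fundamentalRep (Fin 2))
          hW.natFiltration P W U →
        κ t x = P.map (U t)) :
    ∃ (t₀ : ℝ≥0) (ν : Measure (GaugeConfig 3 L (Matrix.specialUnitaryGroup (Fin 2) ℂ))),
      ν ≠ 0 ∧ ∀ z, ν ≤ κ t₀ z := by
  classical
  haveI := secondCountableTopology_su2
  haveI := borelSpace_config L
  haveI : IsProbabilityMeasure (haarProbability (Matrix.specialUnitaryGroup (Fin 2) ℂ)) := inferInstance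
  set H : Measure (GaugeConfig 3 L (Matrix.specialUnitaryGroup (Fin 2) ℂ)) :=
    Measure.pi fun _ : Edge 3 L => haarProbability (Matrix.specialUnitaryGroup (Fin 2) ℂ) with hH
  haveI : IsProbabilityMeasure H := by rw [hH]; infer_instance
  refine ⟨2, ENNReal.ofReal ((1 / 2 : ℝ) ^ Fintype.card (Edge 3 L)) • H, ?_, fun z => ?_⟩
  · intro h0
    have h1 := congrArg (fun μ : Measure _ => μ Set.univ) h0
    simp only [Measure.smul_apply, measure_univ, smul_eq_mul, mul_one, Measure.coe_zero, Pi.zero_apply,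
      ENNReal.ofReal_eq_zero, not_le.2 (by positivity : (0:ℝ) < (1 / 2 : ℝ) ^ Fintype.card (Edge 3 L))] at h1
  · -- realise `κ 2 z` by the regular flow on the product Wiener space
    haveI := isProbabilityMeasure_piWiener (Edge 3 L × NoiseIdx 2)
    have hWc := isFlatBrownian_piWiener 3 L (NoiseIdx 2)
    obtain ⟨Uc, G, hUc, -, -, -, -⟩ := exists_regularFlow L 0 hWc
    rw [hreal 2 z _ _ _ hWc (Uc z) (hUc z).1 (hUc z).2,
      map_eq_heatKernel_beta_zero (t := 2) (by norm_num) z hWc (hUc z).1 (hUc z).2, ← hH,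
      ← withDensity_const]
    refine withDensity_mono (Filter.Eventually.of_forall fun y => ?_)
    exact ENNReal.ofReal_le_ofReal (pow_half_le_prod_heatKernelSU2 (by norm_num) z y)

end Summit.QuantumFields.YangMills.Theorems.ColdStartUniversality

end
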